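import Summits.BirchSwinnertonDyer.BirchSwinnertonDyer.Theorems.AlignedTransportAtTwoMainConjectureOfRankZeroBSDAtTwoSelmerLayerMuDoor
import Summits.BirchSwinnertonDyer.BirchSwinnertonDyer.Theorems.AlignedTransportAtTwoMainConjectureOfRankZeroBSDAtTwoSeedKernelEC
import HarnessLib

/-!
# Route `AlignedTransportAtTwo`, crux C2 `MainConjectureOfRankZeroBSDAtTwo` (stmt-BirchSwinnertonDyer-22298):
# C2 PER CURVE FROM PRINT₄ + ONE TWO-LAYER `2`-DESCENT INEQUALITY — the Selmer rank-jump `μ`-door composed with the seed engine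

HONEST FRAMING (cell `bsd-f1-sign2`, WIDTH-5 attached prover seat `bsd-line-att-p5` gen 43 on line `birth` of the lead
`bsd-line-att-p2`; `--supports` stmt-BirchSwinnertonDyer-22298, closes nothing; BSD is NOT proved by any of this; the crux
C2, its verdict «blocked-on `Rank1Residual.GreenbergMuConjectureIrreducible`» and every registered stub are untouched).
THEOREMS ONLY — no `def`, no instance, no named fact, no `sorry`. CONDITIONAL on the four PRINT named facts of the seed engine
(att-p3 g13 `…SeedKernelEC.mazurMainConjecture_two_of_bsdp_of_mu_eq_zero`): Kato 17.4 (1)(2) at `2` (`h17`), the period unit at `2`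
(`hper`), modularity (`hmod`), Gross–Zagier–Kolyvagin (`hGZK`).

The seed engine turns `BSD₂(W)` + `r_an = 0` + «`μ₂(X(W/ℚ_∞)) = 0` for every `Λ`-torsion cyclotomic dual datum» into Mazur's `2`-adic
main conjecture for `W`. This seat's door (`…SelmerLayerMuDoor.seedMuZero_of_selmer_rankJump_two`) supplies the `μ`-input, for EVERY
cyclotomic datum, from ONE inequality between `2`-descents at two layers of the cyclotomic `ℤ₂`-tower. Hence:

* ★★★★ `mazurMainConjecture_two_of_bsdp_of_selmer_rankJump` — **per curve: PRINT₄ + `W` good ordinary at `2` without rational `2`-torsion,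
  `r_an(W) = 0`, `BSD₂(W)`, and, for the cyclotomic `ℤ₂`-extension `κ`, ONE pair of layers `j < k` with
  `#Sel_k[2] · #ker g_k · 2^{2^j} < #Sel_j[2] · 2^{2^k}` ⟹ `MazurMainConjecture W 2`.** No `μ`-inequality (MuIneqʳ), no Lim door, no
  cubic / sextic field, no class group: road (a) alone. (`Sel_n = W.selmerLayer κ n ≃ Sel_{2^∞}(E_{ℚ_n}/ℚ_n)`, g39; the layers `ℚ_n`
  and these numbers do not depend on WHICH cyclotomic `κ : Γ_ℚ ↠ ℤ₂` is used — in Lean the hypothesis is stated for each `κ`.)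
* ★★★ `mainConjectureOfRankZeroBSDAtTwo_of_selmer_rankJump` — **the crux C2 BY NAME from PRINT₄ + the class-wide descent statement
  «every seed-cell curve opens the Selmer rank-jump door at some pair of layers»** (a semi-decidable, curve-by-curve hypothesis in place
  of Greenberg's `μ`-conjecture; by `IwasawaModuleRankJump.muInvariant_eq_zero_iff_exists_card_lt` it is implied by T up to the
  boundedness of `#ker g_n`, Lemma 3.5).

References: R. Greenberg, LNM 1716 (1999), §1 Conj. 1.11, Thm. 4.1 [GreenbergLNM1716]; K. Kato, Astérisque 295 (2004), Thm. 17.4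
[Kato2004Asterisque]; L. Washington, GTM 83, §13.3 [Washington1997]; T. Fukuda, Proc. Japan Acad. 70 (1994) [Fukuda1994].
-/

set_option linter.dupNamespace false
set_option autoImplicit false

noncomputable section

open scoped Classical MatrixGroups ModularForm AddSubgroup

open CongruenceSubgroup WeierstrassCurve Literature.NumberTheory.EllipticCurves
  Literature.NumberTheory.EllipticCurves.ModularForms
  Literature.NumberTheory.EllipticCurves.Rank1Residual
  Literature.NumberTheory.EllipticCurves.Rank1Residual.Typed
  Literature.NumberTheory.EllipticCurves.Greenberg1999
  Literature.NumberTheory.EllipticCurves.Module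
  Literature.NumberTheory.IwasawaTheory
  Summit.BirchSwinnertonDyer.Rank1Residual
  Summit.BirchSwinnertonDyer.Rank1Residual.X1.MuLambda
  Summit.BirchSwinnertonDyer.Rank1Residual.X1.MuPart
  Summit.BirchSwinnertonDyer.Rank1Residual.X5
  Summit.BirchSwinnertonDyer.Rank1Residual.F1Sign2
  Summit.BirchSwinnertonDyer.BirchSwinnertonDyer.Theorems.Rank1ResidualX1Defs
  Summit.BirchSwinnertonDyer.BirchSwinnertonDyer.Theses.AlignedTransportAtTwo
  Summit.BirchSwinnertonDyer.BirchSwinnertonDyer.Theorems.AlignedTransportAtTwoSeedKernelEC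
  Summit.BirchSwinnertonDyer.BirchSwinnertonDyer.Theorems.AlignedTransportAtTwoSelmerLayerMuDoor

namespace Summit.BirchSwinnertonDyer.BirchSwinnertonDyer.Theorems.AlignedTransportAtTwoSelmerLayerMuDoorCrux

variable (W : WeierstrassCurve ℚ) [W.IsElliptic] [W.IsGloballyMinimal]

/-- ★★★★ **MAZUR'S `2`-ADIC MAIN CONJECTURE FOR A SEED FROM PRINT₄ + ONE TWO-LAYER `2`-DESCENT INEQUALITY.** For `W/ℚ` globally minimal,
good ordinary at `2`, without rational `2`-torsion, with `r_an(W) = 0` and `BSD₂(W)`: if for the cyclotomic `ℤ₂`-extension `κ` (each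
presentation) there is ONE pair of layers `j < k` with `#Sel_k[2] · #ker g_k · 2^{2^j} < #Sel_j[2] · 2^{2^k}` (`Sel_n = W.selmerLayer κ n`,
`ker g_n = W.KerG κ n`), then `MazurMainConjecture W 2` — modulo PRINT₄ {Kato 17.4 (1)(2) at `2`, period unit, modularity, GZK}. The
`μ₂ = 0` input of the seed engine is the door `seedMuZero_of_selmer_rankJump_two`; nothing else of the crux's `μ`-side is used.
[cite: GreenbergLNM1716, §1 Conj. 1.11 and Thm. 4.1] [cite: Kato2004Asterisque, Thm. 17.4 (1)(2) (p. 273)] [cite: Washington1997, §13.3 Prop. 13.23] -/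
theorem mazurMainConjecture_two_of_bsdp_of_selmer_rankJump
    (h17 : ∀ [NeZero (W.conductorNorm ℤ)] (f : CuspForm (Gamma0 (W.conductorNorm ℤ)) 2),
      kato_divisibility_allPrimes W 2 (f := f))
    (hper : realPeriodRat_eq_unit_mul_plusPeriod_two) (hmod : nonempty_modularParametrizationData)
    (hGZK : rank_eq_analyticRank_of_analyticRank_le_one) (hord : IsOrdinaryAt W 2)
    (ht : ∀ x : ℚ, ¬ HasRationalTwoTorsionX W x) (hr : W.analyticRank = 0) (hbsd : BSDp W 2)
    (hjump : ∀ κ : ZpExtension ℚ 2, κ.IsCyclotomic →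
      ∃ j k : ℕ, j < k ∧
        Nat.card ((↥(W.selmerLayer κ k))[(2 : ℤ)]) * Nat.card (W.KerG κ k) * 2 ^ (2 ^ j) <
          Nat.card ((↥(W.selmerLayer κ j))[(2 : ℤ)]) * 2 ^ (2 ^ k)) :
    MazurMainConjecture W 2 :=
  mazurMainConjecture_two_of_bsdp_of_mu_eq_zero W h17 hper hmod hGZK hord ht hr hbsd
    (fun κ _ hκ hγ _ D _ ↦ by
      obtain ⟨j, k, hjk, hlt⟩ := hjump κ hκ
      exact (seedMuZero_of_selmer_rankJump_two W hord ht κ hκ hγ D hjk hlt).2.1)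

/-- ★★★ **The crux C2 BY NAME from PRINT₄ + the class-wide descent statement**: if every seed-cell curve (non-CM, good ordinary at `2`,
no rational `2`-torsion, `Δ ∉ ℚ²`, `r_an = 0`, `BSD₂`) opens the Selmer rank-jump door at some pair of layers of its cyclotomic `ℤ₂`-tower,
then `MainConjectureOfRankZeroBSDAtTwo` holds (modulo PRINT₄). The descent statement replaces the OPEN stub T (`SeedMuZeroAtTwo`, Greenberg's
Conj. 1.11 on the cell) by a curve-by-curve SEMI-DECIDABLE hypothesis. CONDITIONAL; closes nothing by itself.
[cite: GreenbergLNM1716, §1 Conj. 1.11] [cite: Kato2004Asterisque, Thm. 17.4 (1)(2) (p. 273)] -/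
theorem mainConjectureOfRankZeroBSDAtTwo_of_selmer_rankJump
    (h17 : ∀ (V : WeierstrassCurve ℚ) [V.IsElliptic] [V.IsGloballyMinimal] [NeZero (V.conductorNorm ℤ)]
      (f : CuspForm (Gamma0 (V.conductorNorm ℤ)) 2), kato_divisibility_allPrimes V 2 (f := f))
    (hper : realPeriodRat_eq_unit_mul_plusPeriod_two) (hmod : nonempty_modularParametrizationData)
    (hGZK : rank_eq_analyticRank_of_analyticRank_le_one)
    (hJ : ∀ (V : WeierstrassCurve ℚ) [V.IsElliptic] [V.IsGloballyMinimal], ¬ V.HasCM → IsOrdinaryAt V 2 →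
      (∀ x : ℚ, ¬ HasRationalTwoTorsionX V x) → ¬ IsSquare V.Δ → V.analyticRank = 0 → BSDp V 2 →
      ∀ κ : ZpExtension ℚ 2, κ.IsCyclotomic →
        ∃ j k : ℕ, j < k ∧
          Nat.card ((↥(V.selmerLayer κ k))[(2 : ℤ)]) * Nat.card (V.KerG κ k) * 2 ^ (2 ^ j) <
            Nat.card ((↥(V.selmerLayer κ j))[(2 : ℤ)]) * 2 ^ (2 ^ k)) :
    MainConjectureOfRankZeroBSDAtTwo := by
  intro V _ _ hcm hord ht hsq hr _ hbsd
  exact mazurMainConjecture_two_of_bsdp_of_selmer_rankJump V (fun f ↦ h17 V f) hper hmod hGZK hord ht hr hbsd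
    (hJ V hcm hord ht hsq hr hbsd)

end Summit.BirchSwinnertonDyer.BirchSwinnertonDyer.Theorems.AlignedTransportAtTwoSelmerLayerMuDoorCrux

end
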